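import Mathlib
import HarnessLib
import Literature.MathematicalPhysics.QuantumLattice.TorusLabelDistance
import Literature.MathematicalPhysics.QuantumLattice.HubbardGridFieldSubstitution
import Literature.MathematicalPhysics.QuantumLattice.SectorisedKernelNorm

/-!
# K3 engine child (`KLRegimeEngineV14`, stmt-HubbardSuperconductivity-19918), stub `stub_engine_scale0`, clause (E4)₀
# `EngineFirstMoments … 0`: the position data of the decay-weighted scale-`0` step (label pseudo-distance, tree weight, leg positions)

Cell gate-hubbard-kl, seat hubbard-kl-k3c2-p1 (row «scale-0 Gram step `stub_engine_scale0`»).  Clause (E4)₀ of `stub_engine_scale0` asks for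
the first space-time MOMENT of the scale-`0` sectorised quartic kernel,
`ε_x³ Σ_x spaceTimeDist(x_i, x_k)·‖klAnisoLegKernel … 0 4 Ω (0, x)‖ ≤ (G.cE4 + Q.cE4|U|)·Klam·|U|`.  It is obtained (files
`…EngineScaleZeroE4*`) from the DECAY-WEIGHTED bi-graded determinant-bounded single-scale step
(`GrassmannWeightedEffectiveActionBiGradedMap.sum_wt_norm_kernel_map_effAction_le_biquartic_of_gramBounded`) run, as for (E1-v4)₀, on the
`N = 4M` time grid (`HubbardGridFieldSubstitution`), with a TREE WEIGHT on the sets of positions (`SubmultiplicativeTreeWeight.IsTreeWeight`):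
`wt(S) = 1 + diam_d(S)`, whose pair value `1 + d(a, b)` dominates the distance.  This file fixes the position data and nothing else:

* `gridLabelDist L Ng β` — the label pseudo-distance on the position set `ZMod Ng × (ℤ/L)²` of the `Ng`-point time grid:
  `(β/Ng)·(cyclic distance of the time indices) + (periodic ℓ^∞ distance of the sites)` (`TorusLabelDistance.cyclicDist`, `torusSiteDist`);
* `gridLabelWt L Ng β S = 1 + labelDiam (gridLabelDist L Ng β) S` — the tree weight;
* `gridLegPos` — the position of a grid leg `(((j, x⃗), σ), c)`: `(j mod Ng, x⃗)`;
* `latticeLegPos Ng` — the position of a sector leg `((i, x⃗), ℓ)` of the `2M`-lattice (`SpaceTimeIdx L M`) inside the `Ng = 4M` grid: `(2i mod Ng, x⃗)`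
  (the route's `spaceTimeDist L M β` is dominated by `gridLabelDist L (4M) β` of these positions: `…E4Geometry`).

Definitions only (bodies are closed forms; `rfl` lemmas); the analytic content is in the sibling files.
-/

noncomputable section

namespace Summit.HubbardSuperconductivity.HubbardSuperconductivity.Theorems.EngineV8

set_option linter.dupNamespace false -- summit = problem name (single-conjunct summit), D-0017

open Real Finset Literature.MathematicalPhysics.QuantumLattice Literature.Probability.LatticeModels
open Literature.Probability.LatticeModels.BattleFederbush

/-- **The label pseudo-distance of the scale-`0` decay bookkeeping** on the position set `ZMod Ng × (ℤ/Lℤ)²` of the `Ng`-point time grid: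
`d((a, x⃗), (b, y⃗)) = (β/Ng)·cyclicDist Ng a b + torusSiteDist x⃗ y⃗` (imaginary-time circle of circumference `β` with `Ng` points, spatial torus
in the periodic `ℓ^∞` distance). -/
def gridLabelDist (L Ng : ℕ) (β : ℝ) (a b : ZMod Ng × TorusSite 2 L) : ℝ :=
  β / Ng * cyclicDist Ng a.1 b.1 + torusSiteDist a.2 b.2

/-- **The tree weight of the scale-`0` decay bookkeeping**: `wt(S) = 1 + diam_d(S)` for `d = gridLabelDist L Ng β` (its pair value
`1 + d(a, b)` dominates the first moment's distance factor). -/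
def gridLabelWt (L Ng : ℕ) (β : ℝ) (S : Finset (ZMod Ng × TorusSite 2 L)) : ℝ :=
  1 + labelDiam (gridLabelDist L Ng β) S

/-- **The position of a grid leg** `(((j, x⃗), σ), c) ↦ (j mod Ng, x⃗)` (spin and charge are invisible). -/
def gridLegPos {L Ng : ℕ} (Y : GridLeg (GridPoint L Ng)) : ZMod Ng × TorusSite 2 L :=
  ((((Y.1.1.1 : ℕ) : ZMod Ng)), Y.1.1.2)

/-- **The position of a sector leg of the `2M`-lattice inside the `Ng`-point grid** (`Ng = 4M` intended): `((i, x⃗), ℓ) ↦ (2i mod Ng, x⃗)`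
(the imaginary time `iβ/(2M) = (2i)β/(4M)`; the sector label `ℓ` is invisible). -/
def latticeLegPos {L M Ns : ℕ} (Ng : ℕ) (Y : SpaceTimeIdx L M × SectorLeg Ns) : ZMod Ng × TorusSite 2 L :=
  ((((2 * (Y.1.1 : ℕ) : ℕ) : ZMod Ng)), Y.1.2)

/-- Unfolding `gridLabelDist`. -/
theorem gridLabelDist_apply (L Ng : ℕ) (β : ℝ) (a b : ZMod Ng × TorusSite 2 L) :
    gridLabelDist L Ng β a b = β / Ng * cyclicDist Ng a.1 b.1 + torusSiteDist a.2 b.2 := rfl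

/-- Unfolding `gridLabelWt`. -/
theorem gridLabelWt_apply (L Ng : ℕ) (β : ℝ) (S : Finset (ZMod Ng × TorusSite 2 L)) :
    gridLabelWt L Ng β S = 1 + labelDiam (gridLabelDist L Ng β) S := rfl

/-- Unfolding `gridLegPos`. -/
theorem gridLegPos_apply {L Ng : ℕ} (Y : GridLeg (GridPoint L Ng)) :
    gridLegPos Y = ((((Y.1.1.1 : ℕ) : ZMod Ng)), Y.1.1.2) := rfl

/-- Unfolding `latticeLegPos`. -/
theorem latticeLegPos_apply {L M Ns : ℕ} (Ng : ℕ) (Y : SpaceTimeIdx L M × SectorLeg Ns) :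
    latticeLegPos Ng Y = ((((2 * (Y.1.1 : ℕ) : ℕ) : ZMod Ng)), Y.1.2) := rfl

end Summit.HubbardSuperconductivity.HubbardSuperconductivity.Theorems.EngineV8

end
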